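import Summits.SmoothPoincare4.SmoothPoincare4.Theses.CylinderEntropy
import Summits.SmoothPoincare4.SmoothPoincare4.Theorems.CylinderEntropyCylinderRungTwoSurgeryTopology
import Summits.SmoothPoincare4.SmoothPoincare4.Theorems.CylinderEntropyCylinderRungTwoRelaxationOfAreaToFloor
import Summits.SmoothPoincare4.SmoothPoincare4.Theorems.CylinderEntropyCylinderRungTwoHamiltonMonotonicity
import Summits.SmoothPoincare4.SmoothPoincare4.Theorems.CylinderEntropyImmortalAreaToFloor
import Literature.Topology.FourManifolds.HomotopyS4CompactProofs
import Literature.Topology.FourManifolds.HomotopyS4SimplyConnected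
import Literature.Topology.FourManifolds.SphereSimplyConnected
import HarnessLib

/-!
# Route `CylinderEntropy`, item `RungTwoOfSurgeryResolution` (stmt-SmoothPoincare4-18047):
# the glue of the strategist's split of the deciding crux — `CylinderSurgeryResolution → NearSliceRecognition → CylinderRungTwo`

The recognition crux `CylinderRungTwo` (R, stmt-SmoothPoincare4-7631) follows from
* (X₁) `CylinderSurgeryResolution` (stmt-SmoothPoincare4-18045): every thin end-separating cross-section embedding of a compact
  connected 4-manifold into `N = S⁴ × ℝ` has a slice in the least predicate closed under the six rules of the surgery tree
  (discard · flow · reparametrise · cut a separating neck · cut a non-separating neck · immortal thin separating flow), and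
* (X₂) `NearSliceRecognition` (stmt-SmoothPoincare4-18046): some `ε > 0` recognises every compact connected simply connected
  cross-section with `λ_cyl < 1 + ε` as `S⁴`.

Proof (this file, sorry-free, standard axioms; the same seam as the planner's evidence file `CylinderEntropyCylinderRungTwoSplit.lean`,
re-written by the lead of line `killing-flux` because planners cannot write under `Theorems/`):
1. `resolvable_of_surgeryResolution` — X₁ instantiated at the inductive predicate `KillingFlux.CylNeckSurgeryResolvable` (its six
   constructors ARE the six closure rules) gives a `CylNeckSurgeryResolvable` slice;
2. `immortalLeafRecognition_of_nearSlice` — the immortal leaves of the surgery tree (immortal thin separating smooth flows of a compact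
   connected simply connected carrier) are recognised by X₂: by the PROVED immortal half `areaToFloor` (item 17197, p144604), Hamilton's
   monotonicity (`stub_hamiltonMonotonicity`) and the relaxation glue (`stub_relaxationOfAreaToFloor`) a late slice has `λ_cyl < 1 + ε`;
3. a homotopy 4-sphere is compact, connected and simply connected (tree), and the Daniels-Holgate backward induction over the surgery
   tree + Kervaire–Milnor (`helper_cylNeckSurgeryTopology`) conclude `M ≅ S⁴`.

References: J. M. Daniels-Holgate, Adv. Math. 410 (2022), Thm. 1.3 and §6; M. Kervaire, J. Milnor, Ann. of Math. 77 (1963);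
O. Chodosh, C. Mantoulidis, F. Schulze, Duke Math. J. (2025), Cor. 1.5 (b); R. S. Hamilton, Comm. Anal. Geom. 1 (1993).
-/

noncomputable section

-- the prescribed namespace `Summit.SmoothPoincare4.SmoothPoincare4.…` repeats `SmoothPoincare4`
set_option linter.dupNamespace false

open MeasureTheory Set Function
open scoped Manifold ContDiff ENNReal Topology BigOperators ContinuousMap

namespace Summit.SmoothPoincare4.SmoothPoincare4.Cruxes.CylinderRungTwo.KillingFlux

open Literature.Geometry.Riemannian
open Literature.Geometry.Riemannian.SphericalCylinderEntropy (cylEntropy)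
open Literature.Topology.FourManifolds
open Summit.SmoothPoincare4.SmoothPoincare4.Theses.CylinderEntropy
  (CylinderRungTwo CylinderSurgeryResolution NearSliceRecognition RungTwoOfSurgeryResolution)

/-- **X₁ at the inductive predicate.**  `CylinderSurgeryResolution` (least-predicate phrasing) gives, for every thin
end-separating cross-section embedding `ι` of a compact connected `M`, a slice `κ` with `CylNeckSurgeryResolvable M κ`:
instantiate the universally quantified predicate at `CylNeckSurgeryResolvable`, whose six constructors are exactly the six
closure rules. [cite: DanielsHolgate2022, §2.1 Def. 2.18–2.20] -/
theorem resolvable_of_surgeryResolution (hX : CylinderSurgeryResolution) :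
    ∀ (M : Type) [TopologicalSpace M] [T2Space M] [SecondCountableTopology M]
      [ChartedSpace (EuclideanSpace ℝ (Fin 4)) M] [IsManifold (𝓡 4) ∞ M] [CompactSpace M] [ConnectedSpace M]
      (ι : M → EuclideanSpace ℝ (Fin 6)), Manifold.IsSmoothEmbedding (𝓡 4) (𝓡 6) ∞ ι →
      (∀ x, ∑ i : Fin 5, ι x (Fin.castSucc i) ^ 2 = 1) → SeparatesEnds (Set.range ι) →
      cylEntropy (Set.range ι) < ENNReal.ofReal (4 / Real.exp 1) →
      ∃ κ : M → EuclideanSpace ℝ (Fin 6), CylNeckSurgeryResolvable M κ := by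
  intro M _ _ _ _ _ _ _ ι hι hN hsep hent
  obtain ⟨κ, hκ⟩ := hX M ι hι hN hsep hent
  refine ⟨κ, hκ (fun P _ _ κ' => CylNeckSurgeryResolvable P κ') ?_ ?_ ?_ ?_ ?_ ?_⟩
  · intro P _ _ hP κ'
    exact CylNeckSurgeryResolvable.discard hP κ'
  · intro P _ _ _ _ F ν T₀ T₁ hT hU hemb hN' hi hun hνN hνs hvel h
    exact CylNeckSurgeryResolvable.flow hT ⟨hU, hemb, hN', hi, hun, hνN, hνs, hvel⟩ h
  · intro P P' _ _ _ _ _ κ' e h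
    exact CylNeckSurgeryResolvable.of_diffeomorph h e
  · intro P _ _ _ _ κ' ψ D₁ D₂ hdisj hcover κ₁ κ₂ h₁ h₂
    exact CylNeckSurgeryResolvable.cut κ' D₁ D₂ hdisj hcover κ₁ κ₂ h₁ h₂
  · intro P _ _ _ _ κ' ψ hψ ho hns μ h
    exact CylNeckSurgeryResolvable.cutNonseparating κ' hψ ho hns μ h
  · intro P _ _ _ _ _ _ _ F ν T hF hsep' hthin
    exact CylNeckSurgeryResolvable.immortal hF hsep' hthin

/-- **X₂ recognises the immortal leaves.**  Given `NearSliceRecognition`, every immortal smooth cylinder flow of a compact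
connected simply connected carrier `P` whose slices separate the ends with `λ_cyl < 2` has `P ≅ S⁴`: by the PROVED immortal half
`areaToFloor` (item 17197), Hamilton's monotonicity and the relaxation glue, some late slice has `λ_cyl < 1 + ε` for the `ε` of
X₂. [cite: Hamilton1993, Thm. 4.1] -/
theorem immortalLeafRecognition_of_nearSlice (hX : NearSliceRecognition) :
    ∀ (P : Type) [TopologicalSpace P] [T2Space P] [SecondCountableTopology P]
      [ChartedSpace (EuclideanSpace ℝ (Fin 4)) P] [IsManifold (𝓡 4) ∞ P] [CompactSpace P] [ConnectedSpace P],
      SimplyConnectedSpace P →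
      ∀ (F : ℝ → P → EuclideanSpace ℝ (Fin 6)) (ν : ℝ → P → EuclideanSpace ℝ (Fin 6)) (T : ℝ),
      IsCylinderMCF P F ν T →
      (∀ t, T ≤ t → SeparatesEnds (Set.range (F t))) →
      (∀ t, T ≤ t → Literature.Geometry.Riemannian.SphericalCylinderEntropy.cylEntropy (Set.range (F t)) < 2) →
      Nonempty (P ≃ₘ⟮𝓡 4, 𝓡 4⟯ Metric.sphere (0 : EuclideanSpace ℝ (Fin 5)) 1) := by
  obtain ⟨ε, hε, hrec⟩ := hX
  intro P _ _ _ _ _ _ _ hsc F ν T hflow hsep hent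
  obtain ⟨t₀, hTt₀, hsmall⟩ :=
    stub_relaxationOfAreaToFloor stub_hamiltonMonotonicity areaToFloor P F ν T hflow hsep hent ε hε
  exact hrec P hsc (F t₀) (hflow.isSmoothEmbedding t₀ hTt₀) (hflow.mem_cyl t₀ hTt₀) (hsmall t₀ le_rfl)

/-- **The glue, hypothesis-style**: `CylinderSurgeryResolution → NearSliceRecognition → CylinderRungTwo`. A homotopy 4-sphere is
compact, connected and simply connected (tree); X₁ resolves a slice (`resolvable_of_surgeryResolution`); the immortal leaves are
recognised by X₂ (`immortalLeafRecognition_of_nearSlice`); the topology of the surgery tree (`helper_cylNeckSurgeryTopology`: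
Daniels-Holgate backward induction + Kervaire–Milnor) gives `M ≅ S⁴`.
[cite: DanielsHolgate2022, Thm. 1.3 and proof of Thm. 6.4] [cite: KervaireMilnorAnnals1963, Thm. 1.1] -/
theorem cylinderRungTwo_of_surgeryResolution_of_nearSlice (hX₁ : CylinderSurgeryResolution)
    (hX₂ : NearSliceRecognition) : CylinderRungTwo := by
  intro M _ _ _ _ _ e ι hι hN hsep hent
  haveI : CompactSpace M :=
    Literature.Topology.FourManifolds.compactSpace_of_homotopyEquiv_sphere_four_holds M e
  haveI : PathConnectedSpace M := by
    haveI := Literature.Topology.FourManifolds.pathConnectedSpace_sphere_four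
    exact Literature.Topology.FourManifolds.pathConnectedSpace_of_homotopyEquiv e
  have hsc : SimplyConnectedSpace M :=
    Literature.Topology.FourManifolds.simplyConnectedSpace_of_homotopyEquiv_sphere_four
      Literature.Topology.FourManifolds.simplyConnectedSpace_sphere_four_holds M e
  obtain ⟨κ, hres⟩ := resolvable_of_surgeryResolution hX₁ M ι hι hN hsep hent
  exact helper_cylNeckSurgeryTopology (immortalLeafRecognition_of_nearSlice hX₂) M κ hres hsc

end Summit.SmoothPoincare4.SmoothPoincare4.Cruxes.CylinderRungTwo.KillingFlux

namespace Summit.SmoothPoincare4.SmoothPoincare4.Theorems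

open Summit.SmoothPoincare4.SmoothPoincare4.Cruxes.CylinderRungTwo.KillingFlux

/-- **Item `RungTwoOfSurgeryResolution` (stmt-SmoothPoincare4-18047), verbatim**: `CylinderSurgeryResolution → NearSliceRecognition
→ CylinderRungTwo`. [cite: DanielsHolgate2022, Thm. 1.3] [cite: KervaireMilnorAnnals1963, Thm. 1.1] -/
theorem RungTwoOfSurgeryResolution_proof :
    Summit.SmoothPoincare4.SmoothPoincare4.Theses.CylinderEntropy.RungTwoOfSurgeryResolution :=
  fun h₁ h₂ => cylinderRungTwo_of_surgeryResolution_of_nearSlice h₁ h₂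

end Summit.SmoothPoincare4.SmoothPoincare4.Theorems

end
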